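/-
Origin: expansion seat `planner-pub-hodgecm-qw8-g4-0`, handover #3b 2026-08-18T06:27:34Z (`HOME/pub-hodgecm-qw8-g4/lean/Qw8g4/ToyUnitH0.lean`, md5 bdd601bd, 84 lines);
landed by the gen-7 packager in gate run 25 as `HodgeCM/Model/Toy/ToyUnitH0.lean` (import ^import Qw8g4\.ToyGysinDescent\b→import HodgeCM.Model.Toy.ToyGysinDescent ×1; import ^import Qw8g4\.GysinDescentH0\b→import HodgeCM.StubTree.Qw8GysinDescentH0 ×1).
-/
/-
# F-H0 holds in the exterior toy model; the reduced [QW8] input list is jointly witnessed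

Origin: pub-hodgecm-qw8-g4 (QW8 lineage gen 4); companion of `Qw8g4.GysinDescentH0` (intended target
`HodgeCM/StubTree/Qw8GysinDescentH0.lean`) and follow-up to `HodgeCM.Model.Toy.ToyGysinDescent` (run 24).
Intended target `HodgeCM/Model/Toy/ToyUnitH0.lean`, module `HodgeCM.Model.Toy.ToyUnitH0`.

* `HodgeCM.Toy.fact_unitH0 (D) : (toyModelWith D).Fact_unitH0` — for ANY Hodge datum: the unit class of a toy
  object `X` is `1 = ιMulti ℚ 0 ![] ∈ ⋀⁰ L_X`; `⋀⁰ f (1) = 1`; `1 ∧ z = z`; `⋀⁰ L = ℚ · 1`.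
* `HodgeCM.Toy.fact_gysinDescentB : (toyModelWith exteriorHodgeData).Fact_gysinDescentB` (clause (b) of the
  landed-for-run-24 witness `fact_gysinDescent`).
* `HodgeCM.Toy.descentFactsB_consistent : ∃ U, ModelAxioms ∧ N1 ∧ N2 ∧ N3 ∧ N4 ∧ F4 ∧ F5 ∧ F-H0 ∧ F7d-B ∧ Fact_dimProd`
  (witness `toyModel`): the hypothesis list of `Assembly.COR_CM_of_descentFactsB` minus the geometric input
  `RealisationExistsFace` is jointly satisfiable.
-/
import Summits.HodgeConjecture.HodgeCM.Model.Toy.ToyGysinDescent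
import Summits.HodgeConjecture.HodgeCM.StubTree.Qw8GysinDescentH0

/-! PORT of `HodgeCM/Model/Toy/ToyUnitH0.lean` (HodgeCMPerL run 82) — verbatim mechanical port; provenance in the PORT header line. -/

noncomputable section

open scoped TensorProduct
open exteriorPower Module
open Literature.AlgebraicGeometry.Motives

namespace HodgeCM.Toy

/-- **F-H0 in the exterior toy model** (any Hodge datum `D`): unit classes `1_X = ιMulti ℚ 0 ![] ∈ ⋀⁰ L_X`. -/
theorem fact_unitH0 (D : HodgeData) : (toyModelWith D).Fact_unitH0 := by
  refine ⟨fun X => ιMulti ℚ 0 ![], ?_, ?_, ?_⟩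
  · -- naturality: `⋀⁰ f (ι ![]) = ι (f ∘ ![]) = ι ![]`
    intro X Y f
    show exteriorPower.map 0 f.lin (ιMulti ℚ 0 ![]) = ιMulti ℚ 0 ![]
    rw [map_apply_ιMulti]
    congr 1
    exact Subsingleton.elim _ _
  · -- unit law, read in the exterior algebra: `1 * z = z`
    intro X l z
    apply Subtype.ext
    show ((wedge ℚ X.L 0 l (ιMulti ℚ 0 ![]) z : ⋀[ℚ]^(0 + l) X.L) : ExteriorAlgebra ℚ X.L) =
      (((toyModelWith D).castCoh X (Nat.zero_add l).symm z : ⋀[ℚ]^(0 + l) X.L) : ExteriorAlgebra ℚ X.L)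
    rw [wedge_coe, ιMulti_apply_coe, ExteriorAlgebra.ιMulti_zero_apply, one_mul, coe_castCoh]
  · -- `⋀⁰ L = ℚ · 1`
    intro F n Θ e
    have hsp : e ∈ Submodule.span ℚ (Set.range (ιMulti ℚ 0 (M := ((toyModelWith D).cmProd F Θ).L))) := by
      rw [ιMulti_span]; exact Submodule.mem_top
    have hrange : Set.range (ιMulti ℚ 0 (M := ((toyModelWith D).cmProd F Θ).L)) = {ιMulti ℚ 0 ![]} := by
      ext z
      simp only [Set.mem_range, Set.mem_singleton_iff]
      constructor
      · rintro ⟨v, rfl⟩; rw [Subsingleton.elim v ![]]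
      · rintro rfl; exact ⟨_, rfl⟩
    rw [hrange, Submodule.mem_span_singleton] at hsp
    obtain ⟨r, hr⟩ := hsp
    exact ⟨r, hr.symm⟩

/-- F-H0 holds in `toyModel`. -/
theorem toyModel_fact_unitH0 : toyModel.Fact_unitH0 := fact_unitH0 _

/-- F7d-B holds in the exterior CM-model (clause (b) of `fact_gysinDescent`). -/
theorem fact_gysinDescentB : (toyModelWith exteriorHodgeData).Fact_gysinDescentB :=
  Universe.gysinDescentB_of_gysinDescent fact_gysinDescent

/-- F7d-B holds in `toyModel`. -/
theorem toyModel_fact_gysinDescentB : toyModel.Fact_gysinDescentB := fact_gysinDescentB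

/-- **The reduced generic hypothesis list is jointly satisfiable**: one universe with
`ModelAxioms ∧ N1 ∧ N2 ∧ N3 ∧ N4 ∧ F4 ∧ F5 ∧ F-H0 ∧ F7d-B ∧ Fact_dimProd` — every generic binder of
`Universe.qw8Sufficiency_of_unitH0` / `Assembly.COR_CM_of_descentFactsB`. -/
theorem descentFactsB_consistent :
    ∃ U : Universe, U.ModelAxioms ∧ U.Fact_cupExterior ∧ U.Fact_cup_hodge ∧ U.Fact_pull_H0 ∧ U.Fact_hodge_F0 ∧
      U.Fact_cupAlg ∧ U.Fact_cupAssoc ∧ U.Fact_unitH0 ∧ U.Fact_gysinDescentB ∧ U.Fact_dimProd :=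
  ⟨toyModel, toyModel_modelAxioms, toyModel_fact_cupExterior, toyModel_fact_cup_hodge, toyModel_fact_pull_H0,
    toyModel_fact_hodge_F0, fact_cupAlg, fact_cupAssoc exteriorHodgeData, toyModel_fact_unitH0,
    toyModel_fact_gysinDescentB, toyModel_fact_dimProd⟩

/-- `Qw8Sufficiency` in `toyModel` through the reduced generic cone. -/
theorem toyModel_qw8Sufficiency_of_unitH0 : toyModel.Qw8Sufficiency :=
  Universe.qw8Sufficiency_of_unitH0 toyModel_modelAxioms toyModel_fact_cupExterior toyModel_fact_cup_hodge
    toyModel_fact_pull_H0 toyModel_fact_hodge_F0 fact_cupAlg (fact_cupAssoc exteriorHodgeData) toyModel_fact_unitH0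
    toyModel_fact_gysinDescentB toyModel_fact_dimProd

end HodgeCM.Toy

end
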